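import Summits.HodgeConjecture.HodgeConjecture.Theorems.Ring2WeilCoverageWeilGramLevel33Principal
import Summits.HodgeConjecture.HodgeConjecture.Theorems.Ring2WeilCoverageWeilGramLevel33TypeElevenTraces
import Summits.HodgeConjecture.HodgeConjecture.Theorems.Ring2WeilCoverageWeilGramLevel33SurdTwoTraces
import Summits.HodgeConjecture.HodgeConjecture.Theorems.Ring2WeilCoverageRamifiedTypesLevels33and44
import Summits.HodgeConjecture.HodgeConjecture.Theorems.Ring2WeilCoverageSurdTypesLevel33
import Summits.HodgeConjecture.HodgeConjecture.Theorems.Ring2WeilNormObstructionDescentCensus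
import HarnessLib

/-!
# Weil-type family coverage — THE COMPONENTS OF THE WEIL-TYPE `ℤ[ζ₃₃]`-TENFOLDS, VII: the TYPES on the NO row
# `(33, ℚ(√−11))` — `𝔮₁₁` (degree `11`): determinant `-1814078464`, SPLIT (row W10.11.1); `((5 + √33)/2)` (degree `32`):
# determinant `-5277319168`, class `[−2]`, **NON-SPLIT component `(5, ℚ(√−11), 2)`** — for EVERY `ℚ(√−11)`-balanced CM type

research route conditional on HC_CM; not a corollary; Q11.4-sentence-2 already refuted in dim ≥ 3.

Ring 2, WEIL-TYPE FAMILY-COVERAGE CENSUS (`HOME/WEIL-FAMILY-COVERAGE.md` `## b01`, block b01.41 (B)/(B′)/(C) at `g = 10`: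
«`(33, √−11)`: type `𝔮₁₁`, degree `11 ≡ 1`: SPLIT» and «`(5 + √33)/2`; `32 ≡ 2`, `T = {2,11}`: `(5, ℚ(√−11), 2)`
NON-SPLIT», S-pencil there), part 126 of the `Ring2WeilCoverage*` series; continues parts 123/124/125.  Parts 50 and 54d
(`Ring2WeilCoverageRamifiedTypesLevels33and44`, `Ring2WeilCoverageSurdTypesLevel33`) proved that EVERY
`ℚ(√−11)`-balanced CM type `Φ` of `ℚ(ζ₃₃)` carries `Φ`-positive divisors of both types.  Here:

* §1 type `𝔮₁₁` (`𝔬𝔣₀ = (π₁₁)`, `π₁₁ = ζ³¹(1 − ζ³)(1 − ζ)`): **for EVERY skew `ζ′` of this type `det a = -1814078464`**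
  (part 82 + THEOREM L (i) at `33`); CENSUS FORM (existence from part 50 + determinant); class
  **`[-1814078464] = [−1]·[42592²] = splitDiscriminantClass 5 11`**: the type-`𝔮₁₁` polarised Weil-type
  `ℤ[ζ₃₃]`-tenfolds lie on the SPLIT component (census W10.11.1).
* §2 type `((5 + √33)/2)` (`𝔬𝔣₀ = (ϖ₂)`): **for EVERY skew `ζ′` of this type `det a = -5277319168`**; CENSUS FORM (part
  54d's existence + determinant); class **`[-5277319168] = [−2] ≠ splitDiscriminantClass 5 11`** (`2 ∉ Nm(ℚ(√−11)ˣ)`,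
  ring2-b02's `two_not_mem_norm_eleven`; `T(2) = {2, 11}`): **the type-`((5 + √33)/2)` polarised Weil-type
  `ℤ[ζ₃₃]`-CM tenfolds — which exist on EVERY one of the 252 `ℚ(√−11)`-balanced CM types — lie on the NON-SPLIT
  component `(5, ℚ(√−11), 2)`** (census row W10.11.2), with the right sign `(−1)⁵ det a > 0`.

HONEST FRAMING as parts 120/121; `HC_CM` is used nowhere.  No `def`, no named fact, no `sorry`.

References: [cite: vanGeemen1994HodgeAV, Lemma 5.2 (2)–(4), 5.4 and (5.4.1)]; [cite: Shimura1998, §14.3 Prop. 4–5,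
pp. 103–104]; [cite: Serre1973, Ch. III §1]; census b01.41 (B)/(B′)/(C) (seat-derived).
-/

noncomputable section

open Polynomial NumberField Module
open scoped nonZeroDivisors

namespace Summit.HodgeConjecture.Ring2WeilCoverage.WeilGramLevel33Types

open Literature.AlgebraicGeometry.VanGeemen1994 (weilField weilNormResidueGroup)
open Literature.AlgebraicGeometry.Motives (CMType normUnitsSubgroup)
open Literature.NumberTheory.ComplexMultiplication
open Summit.HodgeConjecture.Ring2WeilCoverage.WeilGramTools
open Summit.HodgeConjecture.Ring2WeilCoverage.WeilGramCMPoint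
open Summit.HodgeConjecture.Ring2WeilCoverage.RealUnitNormHalfSystems (complexConj_eq_inv)
open Summit.HodgeConjecture.Ring2WeilCoverage.CyclotomicPrincipalObstruction (complexConj_xi)
open Summit.HodgeConjecture.Ring2WeilCoverage.CyclotomicDifferent (isOfType_one_xi_top xi_ne_zero)
open Summit.HodgeConjecture.HodgeConjecture.Ring2.WeilCoverage (mk_neg_eq_split_of_odd mk_neg_ne_split_of_odd
  mk_eq_split_of_even mk_ne_split_of_even mem_normUnitsSubgroup_of_sq_add_mul_sq natCast_not_mem_normUnitsSubgroup_of_ramified)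
open Summit.HodgeConjecture.HodgeConjecture.Ring2.Hypotheses (splitDiscriminantClass)
open Summit.HodgeConjecture.Ring2WeilCoverage.WeilGramLevel33
open Summit.HodgeConjecture.Ring2WeilCoverage.WeilGramLevel33Principal
open Summit.HodgeConjecture.Ring2WeilCoverage.WeilGramLevel33TypeElevenTraces
open Summit.HodgeConjecture.Ring2WeilCoverage.WeilGramLevel33SurdTwoTraces
open Summit.HodgeConjecture.Ring2WeilCoverage.CyclotomicUnconditionalSqrtNegEleven (norm_realUnits_pos_thirtyThree)
open Summit.HodgeConjecture.Ring2WeilCoverage.RamifiedTypes (isOfType_one_gen_mul_xi complexConj_gen_mul_xi gen_ne_zero)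
open Summit.HodgeConjecture.Ring2WeilCoverage.RamifiedTypesLevels33and44 (adm_thirtyThree exists_type_thirtyThree_sqrt_neg_eleven)
open Summit.HodgeConjecture.Ring2WeilCoverage.RealGeneratorTypes (isOfType_one_mul_xi complexConj_mul_xi)
open Summit.HodgeConjecture.Ring2WeilCoverage.SurdTypesLevel33 (signSet_thirtyThree_two coe_surd_thirtyThree exists_type_thirtyThree_two_sqrt_neg_eleven)
open Summit.HodgeConjecture.Ring2WeilNormDescent (two_not_mem_norm_eleven)
variable {K : Type} [Field K] [NumberField K] {ζ : K}

/-- `𝐞(t) = exp(2πi t/n) ∈ ℂ` (`ZMod.toCircle`). -/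
local notation3 (prettyPrint := false) "𝐞 " t:max => ((ZMod.toCircle t : Circle) : ℂ)

/-- the residue set `S_Φ` read at level `33`. -/
local notation3 (prettyPrint := false) "SΦ[" Φ "," z "]" =>
  (Finset.univ.filter fun t : ZMod 33 => ∃ σ ∈ (Φ : CMType K).1, σ (z : K) = 𝐞 t)

/-! ### §1 Type `𝔮₁₁`: invariance, census form, class SPLIT (row W10.11.1) -/

/-- **For EVERY skew `ζ′` of type 𝔮₁₁ (degree `11`) on `ℤ[ζ_33]` (`IsOfType 1 ζ′ 𝔣₀`, `𝔬𝔣₀ = (π)`, `(𝔬𝔣₀)¹⁰ = (11)`, degree `11`; `ζ′ = u·πξ`,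
`u` a real unit of norm `1` by THEOREM L (i) at `33`) the Gram determinant of `(E_ζ′, s₁₁)` in the frame `θ^i` is `-1814078464`**
(they exist on every `ℚ(√−11)`-balanced `Φ`, part 50): the SPLIT row for `ℚ(√−11)` at `g = 10` (census W10.11.1 `= (5, ℚ(√−11), 1)`); `(−1)⁵ det a > 0`, the right sign for Weil signature `(5,5)` [vG94 5.2 (4)].
research route conditional on HC_CM; not a corollary; Q11.4-sentence-2 already refuted in dim ≥ 3. [cite: vanGeemen1994HodgeAV, Lemma 5.2 (3)–(4) and (5.4.1)] [cite: Shimura1998, §14.3 Prop. 4–5, pp. 103–104] -/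
theorem det_realPart_typeEleven_sqrtNegEleven [IsCyclotomicExtension {33} ℚ K] [IsCMField K]
    (hζ : IsPrimitiveRoot ζ 33) {𝔣₀ : Ideal (𝓞 (maximalRealSubfield K))}
    (h𝔣₀ : 𝔣₀.map (algebraMap (𝓞 (maximalRealSubfield K)) (𝓞 K)) = Ideal.span {hζ.toInteger ^ 31 * (1 - hζ.toInteger ^ 3) * (1 - hζ.toInteger ^ 1)})
    {ζ' : K} (hζ' : IsCMField.complexConj K ζ' = -ζ')
    (hT : CMTypeLattice.IsOfType (1 : (FractionalIdeal (𝓞 K)⁰ K)ˣ) ζ' 𝔣₀)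
    {x : Fin 10 → K} (hx : ∀ i, x i = (ζ + ζ⁻¹) ^ (i : ℕ)) {a : Matrix (Fin 10) (Fin 10) ℚ}
    (ha : ∀ i j, a i j = Algebra.trace ℚ K (ζ' * x i * IsCMField.complexConj K ((1 + 2 * (ζ ^ 3 + ζ ^ 9 + ζ ^ 12 + ζ ^ 15 + ζ ^ 27)) * x j))) :
    a.det = -1814078464 := by
  obtain ⟨ωb, hωb⟩ := exists_basis_thetaPow hζ
  have hx' : ∀ i, x i = (ωb i : K) := fun i => (hx i).trans (hωb i).symm
  have hg : Nat.totient 33 = 2 * (9 + 1) := by decide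
  have hsk : IsCMField.complexConj K (ζ ^ 31 * (1 - ζ ^ 3) * (1 - ζ) * (ζ ^ 9 * (aeval ζ (derivative (cyclotomic 33 ℚ)))⁻¹)) =
      -(ζ ^ 31 * (1 - ζ ^ 3) * (1 - ζ) * (ζ ^ 9 * (aeval ζ (derivative (cyclotomic 33 ℚ)))⁻¹)) := by
    simpa only [pow_one] using complexConj_gen_mul_xi hζ hg adm_thirtyThree
  have h0 : (ζ ^ 31 * (1 - ζ ^ 3) * (1 - ζ) * (ζ ^ 9 * (aeval ζ (derivative (cyclotomic 33 ℚ)))⁻¹)) ≠ 0 :=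
    mul_ne_zero (by simpa only [pow_one] using gen_ne_zero hζ adm_thirtyThree) (xi_ne_zero hζ 9)
  have hT₀ : CMTypeLattice.IsOfType (1 : (FractionalIdeal (𝓞 K)⁰ K)ˣ) (ζ ^ 31 * (1 - ζ ^ 3) * (1 - ζ) * (ζ ^ 9 * (aeval ζ (derivative (cyclotomic 33 ℚ)))⁻¹)) 𝔣₀ := by
    simpa only [pow_one] using isOfType_one_gen_mul_xi hζ 9 ((3, 1, 31) : ℕ × ℕ × ℕ) h𝔣₀
  rw [det_realPart_eq_of_isOfType ωb (complexConj_sqrtNegEleven hζ) hx' (norm_realUnits_pos_thirtyThree hζ)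
    hsk h0 hζ' hT₀ hT (fun i j => rfl) ha]
  exact det_realPart_piEleven_sqrtNegEleven hζ hx (fun i j => rfl)

open scoped Classical in
/-- **CENSUS FORM** (part 50's existence + the determinant): for every CM type `Φ` of `ℚ(ζ_33)` balanced for `N_K = {2, 7, 8, 10, 13, 17, 19, 28, 29, 32}` (Weil signature `(5,5)`
for `K_d = ℚ(√−11)`) and the type `𝔣₀` above, `ℂ^Φ/Φ(ℤ[ζ_33])` carries a `Φ`-positive divisor of type `(K; Φ; 𝔣₀)`, and
EVERY such divisor `X_ζ′` has van Geemen Gram determinant `-1814078464` in the real frame `θ^i`: the SPLIT row for `ℚ(√−11)` at `g = 10` (census W10.11.1 `= (5, ℚ(√−11), 1)`).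
research route conditional on HC_CM; not a corollary; Q11.4-sentence-2 already refuted in dim ≥ 3. [cite: vanGeemen1994HodgeAV, Lemma 5.2 (3)–(4) and (5.4.1)] [cite: Shimura1998, §14.3 Prop. 4–5, pp. 103–104] -/
theorem exists_typeEleven_sqrtNegEleven_det [IsCyclotomicExtension {33} ℚ K] [IsCMField K]
    (hζ : IsPrimitiveRoot ζ 33) (Φ : CMType K)
    (hbal : 2 * (SΦ[Φ, ζ] ∩ ({2, 7, 8, 10, 13, 17, 19, 28, 29, 32} : Finset (ZMod 33))).card = (SΦ[Φ, ζ]).card)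
    {𝔣₀ : Ideal (𝓞 (maximalRealSubfield K))}
    (h𝔣₀ : 𝔣₀.map (algebraMap (𝓞 (maximalRealSubfield K)) (𝓞 K)) =
      Ideal.span {hζ.toInteger ^ 31 * (1 - hζ.toInteger ^ 3) * (1 - hζ.toInteger ^ 1)}) :
    ∃ ζ' : K, IsCMField.complexConj K ζ' = -ζ' ∧ (∀ φ : Φ.1, 0 < (φ.1 ζ').im) ∧
      CMTypeLattice.IsOfType (1 : (FractionalIdeal (𝓞 K)⁰ K)ˣ) ζ' 𝔣₀ ∧
      ∀ (x : Fin 10 → K), (∀ i, x i = (ζ + ζ⁻¹) ^ (i : ℕ)) → ∀ a : Matrix (Fin 10) (Fin 10) ℚ,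
        (∀ i j, a i j = Algebra.trace ℚ K (ζ' * x i * IsCMField.complexConj K ((1 + 2 * (ζ ^ 3 + ζ ^ 9 + ζ ^ 12 + ζ ^ 15 + ζ ^ 27)) * x j))) →
        a.det = -1814078464 := by
  obtain ⟨ζ', h1, h2, h3⟩ := exists_type_thirtyThree_sqrt_neg_eleven hζ Φ hbal h𝔣₀
  exact ⟨ζ', h1, h2, h3, fun x hx a ha => det_realPart_typeEleven_sqrtNegEleven hζ h𝔣₀ h1 h3 hx ha⟩

/-- **`[-1814078464] = [−1]·[1814078464]` is the SPLIT class `splitDiscriminantClass 5 11` in `ℚˣ/Nm(ℚ(√−11)ˣ)`** (`1814078464 = 42592² + 11·0² ∈ Nm`):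
the type-`𝔮₁₁` (degree `11`) polarised Weil-type `ℤ[ζ₃₃]`-CM tenfolds lie on the SPLIT row for `ℚ(√−11)` at `g = 10` (census W10.11.1 `= (5, ℚ(√−11), 1)`).
research route conditional on HC_CM; not a corollary; Q11.4-sentence-2 already refuted in dim ≥ 3. [cite: vanGeemen1994HodgeAV, 5.4 and (5.4.1)] -/
theorem mk0_det_typeEleven_sqrtNegEleven :
    (QuotientGroup.mk (Units.mk0 (-1814078464 : ℚ) (by norm_num)) : weilNormResidueGroup 11) = splitDiscriminantClass 5 11 :=
  mk_neg_eq_split_of_odd (by decide) (by norm_num : (1814078464 : ℚ) ≠ 0)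
    (mem_normUnitsSubgroup_of_sq_add_mul_sq _ (42592 : ℚ) (0 : ℚ) (by norm_num))

/-! ### §2 Type `((5 + √33)/2)`: invariance, census form, class `[−2]` NON-SPLIT -/

/-- **For EVERY skew `ζ′` of type `((5 + √33)/2)` (degree `32`) on `ℤ[ζ_33]` (`IsOfType 1 ζ′ 𝔣₀`, `𝔬𝔣₀ = (ϖ)`, `𝔬𝔣₀·(ϖ₂′) = (2)`, degree `32`; `ζ′ = u·ϖξ`,
`u` a real unit of norm `1` by THEOREM L (i) at `33`) the Gram determinant of `(E_ζ′, s₁₁)` in the frame `θ^i` is `-5277319168`**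
(they exist on every `ℚ(√−11)`-balanced `Φ`, part 54d): the NON-SPLIT component **`(5, ℚ(√−11), 2)`**, `T = {2, 11}` (census row W10.11.2); `(−1)⁵ det a > 0`, the right sign for Weil signature `(5,5)` [vG94 5.2 (4)].
research route conditional on HC_CM; not a corollary; Q11.4-sentence-2 already refuted in dim ≥ 3. [cite: vanGeemen1994HodgeAV, Lemma 5.2 (3)–(4) and (5.4.1)] [cite: Shimura1998, §14.3 Prop. 4–5, pp. 103–104] -/
theorem det_realPart_surdTwo_sqrtNegEleven [IsCyclotomicExtension {33} ℚ K] [IsCMField K]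
    (hζ : IsPrimitiveRoot ζ 33) {𝔣₀ : Ideal (𝓞 (maximalRealSubfield K))}
    (h𝔣₀ : 𝔣₀.map (algebraMap (𝓞 (maximalRealSubfield K)) (𝓞 K)) =
      Ideal.span {(3 + hζ.toInteger ^ 11 + (hζ.toInteger ^ 3 + hζ.toInteger ^ 9 + hζ.toInteger ^ 12 + hζ.toInteger ^ 15 +
        hζ.toInteger ^ 27) + 2 * hζ.toInteger ^ 11 * (hζ.toInteger ^ 3 + hζ.toInteger ^ 9 + hζ.toInteger ^ 12 +
        hζ.toInteger ^ 15 + hζ.toInteger ^ 27) : 𝓞 K)})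
    {ζ' : K} (hζ' : IsCMField.complexConj K ζ' = -ζ')
    (hT : CMTypeLattice.IsOfType (1 : (FractionalIdeal (𝓞 K)⁰ K)ˣ) ζ' 𝔣₀)
    {x : Fin 10 → K} (hx : ∀ i, x i = (ζ + ζ⁻¹) ^ (i : ℕ)) {a : Matrix (Fin 10) (Fin 10) ℚ}
    (ha : ∀ i j, a i j = Algebra.trace ℚ K (ζ' * x i * IsCMField.complexConj K ((1 + 2 * (ζ ^ 3 + ζ ^ 9 + ζ ^ 12 + ζ ^ 15 + ζ ^ 27)) * x j))) :
    a.det = -5277319168 := by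
  obtain ⟨ωb, hωb⟩ := exists_basis_thetaPow hζ
  have hx' : ∀ i, x i = (ωb i : K) := fun i => (hx i).trans (hωb i).symm
  obtain ⟨-, hreal, hϖ0⟩ := signSet_thirtyThree_two hζ
  have hP := coe_surd_thirtyThree hζ
  have hsk := complexConj_mul_xi hζ (by decide : Nat.totient 33 = 2 * (9 + 1)) hreal
  have h0 := mul_ne_zero hϖ0 (xi_ne_zero hζ 9)
  have hT₀ := isOfType_one_mul_xi hζ 9 hP h𝔣₀
  rw [det_realPart_eq_of_isOfType ωb (complexConj_sqrtNegEleven hζ) hx' (norm_realUnits_pos_thirtyThree hζ)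
    hsk h0 hζ' hT₀ hT (fun i j => rfl) ha]
  exact det_realPart_varpiTwo_sqrtNegEleven hζ hx (fun i j => rfl)

open scoped Classical in
/-- **CENSUS FORM** (part 54d's existence + the determinant): for every CM type `Φ` of `ℚ(ζ_33)` balanced for `N_K = {2, 7, 8, 10, 13, 17, 19, 28, 29, 32}` (Weil signature `(5,5)`
for `K_d = ℚ(√−11)`) and the type `𝔣₀` above, `ℂ^Φ/Φ(ℤ[ζ_33])` carries a `Φ`-positive divisor of type `(K; Φ; 𝔣₀)`, and
EVERY such divisor `X_ζ′` has van Geemen Gram determinant `-5277319168` in the real frame `θ^i`: the NON-SPLIT component **`(5, ℚ(√−11), 2)`**, `T = {2, 11}` (census row W10.11.2).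
research route conditional on HC_CM; not a corollary; Q11.4-sentence-2 already refuted in dim ≥ 3. [cite: vanGeemen1994HodgeAV, Lemma 5.2 (3)–(4) and (5.4.1)] [cite: Shimura1998, §14.3 Prop. 4–5, pp. 103–104] -/
theorem exists_surdTwo_sqrtNegEleven_det [IsCyclotomicExtension {33} ℚ K] [IsCMField K]
    (hζ : IsPrimitiveRoot ζ 33) (Φ : CMType K)
    (hbal : 2 * (SΦ[Φ, ζ] ∩ ({2, 7, 8, 10, 13, 17, 19, 28, 29, 32} : Finset (ZMod 33))).card = (SΦ[Φ, ζ]).card)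
    {𝔣₀ : Ideal (𝓞 (maximalRealSubfield K))}
    (h𝔣₀ : 𝔣₀.map (algebraMap (𝓞 (maximalRealSubfield K)) (𝓞 K)) =
      Ideal.span {(3 + hζ.toInteger ^ 11 + (hζ.toInteger ^ 3 + hζ.toInteger ^ 9 + hζ.toInteger ^ 12 + hζ.toInteger ^ 15 +
        hζ.toInteger ^ 27) + 2 * hζ.toInteger ^ 11 * (hζ.toInteger ^ 3 + hζ.toInteger ^ 9 + hζ.toInteger ^ 12 +
        hζ.toInteger ^ 15 + hζ.toInteger ^ 27) : 𝓞 K)}) :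
    ∃ ζ' : K, IsCMField.complexConj K ζ' = -ζ' ∧ (∀ φ : Φ.1, 0 < (φ.1 ζ').im) ∧
      CMTypeLattice.IsOfType (1 : (FractionalIdeal (𝓞 K)⁰ K)ˣ) ζ' 𝔣₀ ∧
      ∀ (x : Fin 10 → K), (∀ i, x i = (ζ + ζ⁻¹) ^ (i : ℕ)) → ∀ a : Matrix (Fin 10) (Fin 10) ℚ,
        (∀ i j, a i j = Algebra.trace ℚ K (ζ' * x i * IsCMField.complexConj K ((1 + 2 * (ζ ^ 3 + ζ ^ 9 + ζ ^ 12 + ζ ^ 15 + ζ ^ 27)) * x j))) →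
        a.det = -5277319168 := by
  obtain ⟨ζ', h1, h2, h3⟩ := exists_type_thirtyThree_two_sqrt_neg_eleven hζ Φ hbal h𝔣₀
  exact ⟨ζ', h1, h2, h3, fun x hx a ha => det_realPart_surdTwo_sqrtNegEleven hζ h𝔣₀ h1 h3 hx ha⟩

/-- **`[-5277319168] = [−2] ≠ splitDiscriminantClass 5 11` in `ℚˣ/Nm(ℚ(√−11)ˣ)`** (`2/5277319168 = (0)² + 11·((1 / 170368))² ∈ Nm`; `2 ∉ Nm(ℚ(√−11)ˣ)` is ring2-b02's `two_not_mem_norm_eleven`):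
the type-`((5 + √33)/2)` (degree `32`) polarised Weil-type `ℤ[ζ₃₃]`-CM tenfolds lie on the NON-SPLIT component **`(5, ℚ(√−11), 2)`**, `T = {2, 11}` (census row W10.11.2).
research route conditional on HC_CM; not a corollary; Q11.4-sentence-2 already refuted in dim ≥ 3. [cite: vanGeemen1994HodgeAV, 5.4 and (5.4.1)] [cite: Serre1973, Ch. III §1] -/
theorem mk0_det_surdTwo_sqrtNegEleven :
    (QuotientGroup.mk (Units.mk0 (-5277319168 : ℚ) (by norm_num)) : weilNormResidueGroup 11) =
        QuotientGroup.mk (Units.mk0 (-2 : ℚ) (by norm_num)) ∧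
      (QuotientGroup.mk (Units.mk0 (-2 : ℚ) (by norm_num)) : weilNormResidueGroup 11) ≠
        splitDiscriminantClass 5 11 := by
  constructor
  · rw [QuotientGroup.eq]
    have e : (Units.mk0 (-5277319168 : ℚ) (by norm_num))⁻¹ * Units.mk0 (-2 : ℚ) (by norm_num) =
        Units.mk0 (((1 / 2638659584)) : ℚ) (by norm_num) := Units.ext (by norm_num)
    rw [e]
    exact mem_normUnitsSubgroup_of_sq_add_mul_sq _ (0 : ℚ) ((1 / 170368) : ℚ) (by norm_num)
  · exact mk_neg_ne_split_of_odd (by decide) _ two_not_mem_norm_eleven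

end Summit.HodgeConjecture.Ring2WeilCoverage.WeilGramLevel33Types

end
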